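import Summits.ValiantsHypothesis.ValiantsHypothesis.Theorems.LacunarySymmetroidMatrixDescartesDoorA26WallBubblingMultiplicityTransfer

/-!
# Wall bubbling for `DoorA26` — (W) chain piece: THE DOOR STEP (confluent tower + multiplicity transfer ⇒ no twenty in the limit window)

HONEST FRAMING.  Chain lemma for obligation (W) `stub_weylFaces` of `Cruxes/DoorA26/Lines/wall_bubbling.lean` (stmt-ValiantsHypothesis-19979
`DoorA26`; OPEN, typed, never asserted), re-pointed seat val-sym-door-p1 g13 (W2 #7).  The line lead's rev-3 statement file
`Cruxes/DoorA26/Lines/wall_bubbling_ConfluentDoor.lean` (@778d8e89d906) types the door `ConfluentDoor26` in LOG-currency with multiplicity: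
`confluentDet e τ T S t := det(exp(e₀ t)•(τ + t•T) + Σ_k exp(e_{k+1} t)•S_k)`, and `(∃ t, F t ≠ 0) → ∀ Z m, (∀ z ∈ Z, ∀ j < m z, iteratedDeriv j F z = 0) →
Σ m z ≤ 19`.  This file is the LAST STEP of the reduction «ConfluentDoor26 ⇒ Stmt.weylFaces_generic» in kernel form, with the door INLINED as a
hypothesis (def-free file; `Cruxes/` is not importable from `Theorems/`):

* `multiplicity_transfer_iteratedDeriv` — W2 #5 `multiplicity_transfer` in `iteratedDeriv` currency for smooth approximants and limit;
* `contDiff_confluentDet` — the confluent determinant (inlined expression) is `C^n` for every `n`;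
* `no_twenty_window_of_confluentDoor` — THE DOOR STEP: if smooth window functions `f ν` converge to the (inlined) confluent determinant CONTINUOUSLY
  WITH ALL DERIVATIVES up to order 19 on `[A,B]` and each has `20` distinct zeros in `[A,B]`, then — given the door (inlined, as a hypothesis) and
  `∃ t, F t ≠ 0` — `False`.

What remains for the reduction (successor-sized, report §68 (g) steps (1)–(3)): LEVEL SELECTION producing, from an accumulation of twenties at a
generic Weyl face in the third-level regime, exactly these hypotheses (W2 #6 `…ClassMoments` is its Taylor input).  On the guard `hne`
(`∃ t, F t ≠ 0`, crit-2 g4's co-read item (4), bus 2026-08-28T17:13Z; LINE RULE of the line lead 17:17Z): it is carried here as an EXPLICIT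
hypothesis, never folded into `hconv`, and in the #4′ skeleton it is a NAMED stub (suggested `stub_weylFaces_generic_nondegLimit`: «the limit at the
selected level is not identically zero» — anatomy, OPEN).  Remark for whoever takes it: with SLOT normalisation (some limit slot coefficient non-zero)
it follows from linear independence of the slots `t^m e^{Et}` (a non-zero extended exponential sum is not identically zero, e.g. by
`extSum_card_zeros_le`); with LETTER normalisation it can fail (letters sharing a kernel vector give `F ≡ 0`).  No new definitions; nothing here
bears on `DoorA26`, `MatrixDescartes` (stmt-ValiantsHypothesis-18050) or `VP ≠ VNP`.

[folklore] Smoothness of exponential polynomials; Rolle–Hurwitz (W2 #5).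
-/

-- `Summit.ValiantsHypothesis.ValiantsHypothesis.…` repeats a component by the D-0017 layout
-- (single-conjunct summit), which the `dupNamespace` linter flags; the name is mandated.
set_option linter.dupNamespace false

namespace Summit.ValiantsHypothesis.ValiantsHypothesis.Theorems.LacunarySymmetroidMatrixDescartes.WallBubbling

open Finset Filter Topology
open scoped BigOperators

/-- `multiplicity_transfer` in `iteratedDeriv` currency (smooth approximants). [folklore] -/
theorem multiplicity_transfer_iteratedDeriv {N : ℕ} (A B : ℝ) (f : ℕ → ℝ → ℝ) (F : ℝ → ℝ)
    (hf : ∀ ν (n : ℕ), ContDiff ℝ n (f ν))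
    (hconv : ∀ j < N, ∀ φ : ℕ → ℕ, StrictMono φ → ∀ (t : ℕ → ℝ) (t₀ : ℝ), (∀ k, t k ∈ Set.Icc A B) →
      Tendsto t atTop (𝓝 t₀) → Tendsto (fun k => iteratedDeriv j (f (φ k)) (t k)) atTop (𝓝 (iteratedDeriv j F t₀)))
    (hz : ∀ ν, ∃ z : Fin N → ℝ, StrictMono z ∧ ∀ i, z i ∈ Set.Icc A B ∧ f ν (z i) = 0) :
    ∃ (Z : Finset ℝ) (m : ℝ → ℕ), (∀ z ∈ Z, z ∈ Set.Icc A B ∧ ∀ j < m z, iteratedDeriv j F z = 0) ∧ N ≤ ∑ z ∈ Z, m z := by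
  have hder : ∀ ν j t, HasDerivAt (fun s => iteratedDeriv j (f ν) s) (iteratedDeriv (j + 1) (f ν) t) t := by
    intro ν j t
    have hd := (hf ν (j + 1)).differentiable_iteratedDeriv j (by exact_mod_cast Nat.lt_succ_self j)
    rw [iteratedDeriv_succ]
    exact (hd t).hasDerivAt
  have hz' : ∀ ν, ∃ z : Fin N → ℝ, StrictMono z ∧ ∀ i, z i ∈ Set.Icc A B ∧ (fun s => iteratedDeriv 0 (f ν) s) (z i) = 0 := by
    intro ν; obtain ⟨z, hz1, hz2⟩ := hz ν
    exact ⟨z, hz1, fun i => ⟨(hz2 i).1, by simpa using (hz2 i).2⟩⟩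
  exact multiplicity_transfer A B (fun ν j s => iteratedDeriv j (f ν) s) (fun j s => iteratedDeriv j F s) hder hconv hz'

/-- The confluent determinant `t ↦ det(exp(e₀t)•(τ + t•T) + Σ_k exp(e_{k+1}t)•S_k)` is smooth. [folklore] -/
theorem contDiff_confluentDet (n : WithTop ℕ∞) (e : Fin 5 → ℝ) (τ T : Matrix (Fin 2) (Fin 2) ℝ) (S : Fin 4 → Matrix (Fin 2) (Fin 2) ℝ) :
    ContDiff ℝ n (fun t : ℝ => ((Real.exp (e 0 * t)) • (τ + t • T) + ∑ k, (Real.exp (e k.succ * t)) • S k).det) := by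
  have hentry : ∀ p q, ContDiff ℝ n (fun t : ℝ =>
      ((Real.exp (e 0 * t)) • (τ + t • T) + ∑ k, (Real.exp (e k.succ * t)) • S k) p q) := by
    intro p q
    have h : (fun t : ℝ => ((Real.exp (e 0 * t)) • (τ + t • T) + ∑ k, (Real.exp (e k.succ * t)) • S k) p q)
        = fun t => Real.exp (e 0 * t) * (τ p q + t * T p q) + ∑ k, Real.exp (e k.succ * t) * S k p q := by
      funext t
      simp [Matrix.add_apply, Matrix.smul_apply, Matrix.sum_apply, smul_eq_mul, mul_add]
    rw [h]
    refine ((Real.contDiff_exp.comp (contDiff_const.mul contDiff_id)).mul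
      (contDiff_const.add (contDiff_id.mul contDiff_const))).add (ContDiff.sum fun k _ => ?_)
    exact (Real.contDiff_exp.comp (contDiff_const.mul contDiff_id)).mul contDiff_const
  have h : (fun t : ℝ => ((Real.exp (e 0 * t)) • (τ + t • T) + ∑ k, (Real.exp (e k.succ * t)) • S k).det)
      = fun t => ((Real.exp (e 0 * t)) • (τ + t • T) + ∑ k, (Real.exp (e k.succ * t)) • S k) 0 0 *
          ((Real.exp (e 0 * t)) • (τ + t • T) + ∑ k, (Real.exp (e k.succ * t)) • S k) 1 1 -
        ((Real.exp (e 0 * t)) • (τ + t • T) + ∑ k, (Real.exp (e k.succ * t)) • S k) 0 1 *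
          ((Real.exp (e 0 * t)) • (τ + t • T) + ∑ k, (Real.exp (e k.succ * t)) • S k) 1 0 := by
    funext t; rw [Matrix.det_fin_two]
  rw [h]
  exact ((hentry 0 0).mul (hentry 1 1)).sub ((hentry 0 1).mul (hentry 1 0))

/-- **THE DOOR STEP.**  With the confluent door (rev 3, log-currency, with multiplicity) INLINED as the hypothesis `hdoor`: smooth window functions
converging continuously with all derivatives up to order `19` on `[A,B]` to a non-identically-zero confluent determinant, each with `20` distinct
zeros in `[A,B]`, do not exist. [folklore] -/
theorem no_twenty_window_of_confluentDoor
    (hdoor : ∀ e : Fin 5 → ℝ, Function.Injective e →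
      ∀ τ T : Matrix (Fin 2) (Fin 2) ℝ, ∀ S : Fin 4 → Matrix (Fin 2) (Fin 2) ℝ,
        τ.IsSymm → T.IsSymm → (∀ k, (S k).IsSymm) →
        (∃ t, ((Real.exp (e 0 * t)) • (τ + t • T) + ∑ k, (Real.exp (e k.succ * t)) • S k).det ≠ 0) →
        ∀ (Z : Finset ℝ) (m : ℝ → ℕ),
          (∀ z ∈ Z, ∀ j < m z,
            iteratedDeriv j (fun t => ((Real.exp (e 0 * t)) • (τ + t • T) + ∑ k, (Real.exp (e k.succ * t)) • S k).det) z = 0) →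
          ∑ z ∈ Z, m z ≤ 19)
    (e : Fin 5 → ℝ) (he : Function.Injective e) (τ T : Matrix (Fin 2) (Fin 2) ℝ) (S : Fin 4 → Matrix (Fin 2) (Fin 2) ℝ)
    (hτ : τ.IsSymm) (hT : T.IsSymm) (hS : ∀ k, (S k).IsSymm)
    (hne : ∃ t, ((Real.exp (e 0 * t)) • (τ + t • T) + ∑ k, (Real.exp (e k.succ * t)) • S k).det ≠ 0)
    (A B : ℝ) (f : ℕ → ℝ → ℝ) (hf : ∀ ν (n : ℕ), ContDiff ℝ n (f ν))
    (hconv : ∀ j < 20, ∀ φ : ℕ → ℕ, StrictMono φ → ∀ (t : ℕ → ℝ) (t₀ : ℝ), (∀ k, t k ∈ Set.Icc A B) →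
      Tendsto t atTop (𝓝 t₀) → Tendsto (fun k => iteratedDeriv j (f (φ k)) (t k)) atTop
        (𝓝 (iteratedDeriv j (fun t => ((Real.exp (e 0 * t)) • (τ + t • T) + ∑ k, (Real.exp (e k.succ * t)) • S k).det) t₀)))
    (hz : ∀ ν, ∃ z : Fin 20 → ℝ, StrictMono z ∧ ∀ i, z i ∈ Set.Icc A B ∧ f ν (z i) = 0) : False := by
  obtain ⟨Z, m, hZ, h20⟩ := multiplicity_transfer_iteratedDeriv A B f _ hf hconv hz
  have h19 := hdoor e he τ T S hτ hT hS hne Z m fun z hz' j hj => (hZ z hz').2 j hj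
  omega

end Summit.ValiantsHypothesis.ValiantsHypothesis.Theorems.LacunarySymmetroidMatrixDescartes.WallBubbling
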